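import Literature.NumberTheory.EllipticCurves.KenkuLevelFortyNineProofs
import Literature.NumberTheory.EllipticCurves.IsogenyQuotientCurveProofs
import Literature.NumberTheory.EllipticCurves.SelmerCorankProofs
import Literature.NumberTheory.EllipticCurves.MazurTorsionReductionFourLeavesProofs
import HarnessLib

/-!
# No elliptic curve over `ℚ` has a rational point of order `49` — the `n = 49` leaf of Mazur's
# "First reduction" (`Literature.NumberTheory.EllipticCurves.Mazur1977_reduction_to_primes`),
# from Kenku's level `49` (no rational cyclic `49`-isogeny); the reduction from three leaves

Topic `NumberTheory/EllipticCurves`; theorems only (no definition, no named fact, nothing asserted;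
D-0026 net debt `0`). File 4 of 4 of the `Literature/` PORT of the tree's proved level-`49`
theorem of Kenku (files `KubertSevenRigidityProofs`, `CyclicIsogenyFortyNineMiddleCurveProofs`,
`KenkuLevelFortyNineCoreProofs`, `KenkuLevelFortyNineProofs` — the head theorem
`isogeny_isCyclic_degree_ne_fortyNine` — ported by bsd-cited-r19 from `Summits/ABC/ABC/Theorems/`
under ARM P lead ruling (452)(a)). AUTHORSHIP: the three theorems
`exists_isogeny_isCyclic_degree_eq_of_addOrderOf`, `not_exists_addOrderOf_eq_fortyNine`,
`not_exists_injective_zmod_fortyNine` and `mazurFirstReduction_leaf_fortyNine` are the kit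
`pub/bsd-cited/sheets/r09-leaf49/KubertFortyNineOfKenku.lean` (sha16 `15f33ec6ef00512a`, farm
rc 0, axioms `propext, Classical.choice, Quot.sound`) written by seat **bsd-cited-r09 g9**
(2026-08-27) against the Summits-side `Summit.ABC.ABC.Theorems.isogeny_isCyclic_degree_ne_fortyNine`;
the mathematics and the tactic scripts are r09's — only the namespace (`Literature.…`), the
import of the ported Kenku theorem and this paragraph changed (bsd-cited-r19). The last theorem
`Mazur1977_reduction_to_primes_of_three_leaves` (bsd-cited-r19) feeds the leaf into the tree's
`Mazur1977_reduction_to_primes_of_four_leaves` (file `MazurTorsionReductionFourLeavesProofs`).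

WHAT. This file proves ONE of the nine Diophantine leaves `n ∈ {14, 15, 16, 18, 21, 25, 27, 35, 49}`
that the tree's assembly
`Literature.NumberTheory.EllipticCurves.Mazur1977_reduction_to_primes_of_leaves`
(`Literature/NumberTheory/EllipticCurves/MazurTorsionReductionProofs.lean`) takes as hypotheses
towards the named fact `Mazur1977_reduction_to_primes` (B. Mazur, *Modular curves and the
Eisenstein ideal*, Publ. Math. IHÉS 47 (1977), Ch. III §5, p. 156, "First reduction", after
Kubert 1976, Ch. IV: "`X₁(m)(ℚ)` is cuspidal" for the composite `m`), in the literal shape of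
that hypothesis (`∀ (V : WeierstrassCurve ℚ) [V.IsElliptic], ¬ ∃ P : V.toAffine.Point,
addOrderOf P = 49`), and feeds it into the `n = 49` slot: with the sibling leaves already in the
tree — `not_exists_addOrderOf_eq_fourteen` (`KubertFourteenProofs`), `…_fifteen`
(`KubertFifteenProofs`), `…_twentyOne` (`KubertTwentyOneProofs`), `…_twentySeven`
(`KubertTwentySevenProofs`), `…_sixteen` (`KubertSixteenProofs`) — consolidated by
`Mazur1977_reduction_to_primes_of_five_leaves` / `…_of_four_leaves` (files
`MazurTorsionReductionFiveLeavesProofs` / `…FourLeavesProofs`), the named fact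
`Mazur1977_reduction_to_primes` is now CLOSED MODULO the three leaves `n ∈ {18, 25, 35}`
(`Mazur1977_reduction_to_primes_of_three_leaves`).

THE PROOF (Kubert 1976, Ch. IV, Table / Mazur 1977 p. 156 via Kenku 1982: "`X₁(49)(ℚ)` is
cuspidal because already `X₀(49)(ℚ)` is"). Let `P ∈ E(ℚ)` have order `49`. Its image `Q` in
`E(ℚ̄)` (`WeierstrassCurve.toGeomPoints`, injective) has order `49`, and the cyclic subgroup
`S = ℤQ ⊂ E(ℚ̄)` is finite of order `49` and POINTWISE fixed by `Γ_ℚ` (`smul_toGeomPoints`), in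
particular `Γ_ℚ`-stable. By Silverman, *AEC*, Prop. III.4.12 with Rem. III.4.13.2 (the tree's
DISCHARGED fact `WeierstrassCurve.exists_isogeny_ker_eq_and_comp_eq_nsmul_holds`) there is an
elliptic curve `E'/ℚ` and an isogeny `g : E → E'` over `ℚ` with `ker g = S`: `g` is cyclic
(`Isogeny.IsCyclic`: its kernel `ℤQ` is a cyclic group) of degree `#S = 49` (`Isogeny.degree`
is `#ker`, `Nat.card_zmultiples`). This contradicts Kenku's level `49` (J. Number Theory 15 (1982),
proof of Thm. 1, p. 200; Ligozat 1975: `X₀(49)(ℚ)` consists of the two cusps) — in the tree the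
theorem `isogeny_isCyclic_degree_ne_fortyNine` of file `KenkuLevelFortyNineProofs`
(modular-curve-free: explicit `X₀(49) ≅ 49a1`, `49a1(ℚ) = {O, (2,-1)}`, Klein–Fricke at `7`,
Kubert's rigidity).

## References

* [Mazur1977] B. Mazur, *Modular curves and the Eisenstein ideal*, Publ. Math. IHÉS 47 (1977)
  33–186, Thm. (7') p. 35; Ch. III §5, First reduction, p. 156.
* [Kubert1976] D. S. Kubert, *Universal bounds on the torsion of elliptic curves*, Proc. London
  Math. Soc. (3) 33 (1976) 193–237, Ch. IV (the case `N = 49`: `X₀(49)`).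
* [Kenku1982] M. A. Kenku, *On the number of `ℚ`-isomorphism classes of elliptic curves in each
  `ℚ`-isogeny class*, J. Number Theory 15 (1982) 199–202, proof of Thm. 1, p. 200 (level `49`).
* [Ligozat1975] G. Ligozat, *Courbes modulaires de genre 1*, Mém. SMF 43 (1975) (`X₀(49)`).
* [SilvermanAEC2009] J. H. Silverman, *The Arithmetic of Elliptic Curves*, 2nd ed., GTM 106,
  Prop. III.4.12, Rem. III.4.13.2, VIII.§1.

## Design

Theorems only; `noncomputable section`; the statement carries an ARBITRARY `[DecidableEq ℚ]`
instance (as Mathlib's group law on `V.toAffine.Point` does and as the `n = 14` leaf is stated),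
reduced inside the proof to the instance under which `WeierstrassCurve.toGeomPoints` is an
additive homomorphism by `Subsingleton.elim` (the device of
`MazurTorsionReductionProofs.exists_addMonoidHom_eq_twoIsogenyFun`). Axioms: `propext`,
`Classical.choice`, `Quot.sound`.
-/

noncomputable section

open scoped Classical

namespace Literature.NumberTheory.EllipticCurves

open _root_.WeierstrassCurve

/-- **A rational point of order `m` yields a rational cyclic `m`-isogeny** (Silverman, *AEC*,
Prop. III.4.12 with Rem. III.4.13.2, through the tree's discharged quotient-isogeny fact): for an
elliptic curve `V/K` over a perfect field `K` and `P ∈ V(K)` of finite order `m ≥ 1`, there are an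
elliptic curve `V'/K` and an isogeny `g : V → V'` over `K` whose kernel on `K̄`-points is the
cyclic group `ℤ·P`, so that `g` is cyclic of degree `m`. (Stated for the classical
`DecidableEq K` instance, the one under which `WeierstrassCurve.toGeomPoints` is additive.)
Author: bsd-cited-r09 g9 (kit 15f33ec6ef00512a). [cite: SilvermanAEC2009, Prop. III.4.12 and Rem. III.4.13.2] -/
theorem exists_isogeny_isCyclic_degree_eq_of_addOrderOf {K : Type} [Field K] [PerfectField K]
    (V : WeierstrassCurve K) [V.IsElliptic] (P : V.toAffine.Point) {m : ℕ} (hm : 0 < m)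
    (hP : addOrderOf P = m) :
    ∃ (V' : WeierstrassCurve K) (_ : V'.IsElliptic) (g : Isogeny V V'),
      g.IsCyclic ∧ g.degree = m := by
  -- the image `Q` of `P` in `E(K̄)` and the cyclic subgroup `S = ℤQ`
  set Q : V.geomPoints := V.toGeomPoints P with hQdef
  have hQ : addOrderOf Q = m := by
    rw [hQdef, addOrderOf_injective (V.toGeomPoints) (toGeomPoints_injective V) P, hP]
  have hQfin : IsOfFinAddOrder Q := addOrderOf_pos_iff.mp (hQ ▸ hm)
  set S : AddSubgroup V.geomPoints := AddSubgroup.zmultiples Q with hSdef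
  -- `S` is finite
  have hSfin : (S : Set V.geomPoints).Finite := by
    rw [hSdef]
    exact finite_zmultiples.mpr hQfin
  -- `S` is `Γ_K`-stable (indeed pointwise fixed: `Q` comes from `E(K)`)
  have hSstab : ∀ (σ : Field.absoluteGaloisGroup K) (R : V.geomPoints), R ∈ S → σ • R ∈ S := by
    intro σ R hR
    rw [hSdef, AddSubgroup.mem_zmultiples_iff] at hR
    obtain ⟨k, rfl⟩ := hR
    have hσ : σ • (k • Q) = k • (σ • Q) := map_zsmul (DistribSMul.toAddMonoidHom _ σ) k Q
    rw [hσ, hQdef, smul_toGeomPoints, ← hQdef, hSdef]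
    exact AddSubgroup.zsmul_mem_zmultiples Q k
  -- the quotient isogeny with kernel `S`
  obtain ⟨V', hV', g, -, hker, -, -⟩ :=
    V.exists_isogeny_ker_eq_and_comp_eq_nsmul_holds S hSfin hSstab
  refine ⟨V', hV', g, ?_, ?_⟩
  · -- cyclic: the kernel is `ℤQ`
    show IsAddCyclic g.toAddMonoidHom.ker
    rw [hker, hSdef]
    infer_instance
  · -- degree `= #ℤQ = addOrderOf Q = m`
    show Nat.card g.toAddMonoidHom.ker = m
    rw [hker, hSdef, Nat.card_zmultiples, hQ]

/-- **No rational point of order `49`** (Kubert 1976, Ch. IV, case `N = 49`; the `n = 49` leaf of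
Mazur's First reduction, Mazur 1977 Ch. III §5 p. 156): no elliptic curve over `ℚ` has a
`ℚ`-rational point of order `49`. Proof: such a point gives a rational cyclic `49`-isogeny
(`exists_isogeny_isCyclic_degree_eq_of_addOrderOf`), which Kenku's level `49` — the tree theorem
`isogeny_isCyclic_degree_ne_fortyNine` (`X₀(49)(ℚ)` = the two cusps) — forbids.
Stated for an arbitrary `DecidableEq ℚ` instance, as the group law of `V.toAffine.Point` is.
Author: bsd-cited-r09 g9 (kit 15f33ec6ef00512a). [cite: Kubert1976, Ch. IV (N = 49)]
[cite: Mazur1977, Ch. III §5 p. 156 (First reduction)] [cite: Kenku1982, proof of Thm. 1, p. 200] -/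
theorem not_exists_addOrderOf_eq_fortyNine [inst : DecidableEq ℚ] (V : WeierstrassCurve ℚ)
    [V.IsElliptic] : ¬ ∃ P : V.toAffine.Point, addOrderOf P = 49 := by
  -- reduce to the classical `DecidableEq ℚ` instance (all such instances are equal)
  have hI : inst = fun a b => Classical.propDecidable (a = b) := Subsingleton.elim _ _
  subst hI
  rintro ⟨P, hP⟩
  obtain ⟨V', hV', g, hcyc, hdeg⟩ :=
    exists_isogeny_isCyclic_degree_eq_of_addOrderOf V P (by norm_num) hP
  haveI := hV'
  exact isogeny_isCyclic_degree_ne_fortyNine g hcyc hdeg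

/-- **`ℤ/49ℤ` does not embed in `E(ℚ)`** for an elliptic curve `E/ℚ`: no injective additive
homomorphism `ℤ/49 → V(ℚ)` (the image of `1` would have order `49`). Author: bsd-cited-r09 g9.
[cite: Kubert1976, Ch. IV (N = 49)] [cite: Mazur1977, Thm. (8) and Ch. III §5 p. 156] -/
theorem not_exists_injective_zmod_fortyNine [DecidableEq ℚ] (V : WeierstrassCurve ℚ)
    [V.IsElliptic] : ¬ ∃ f : ZMod 49 →+ V.toAffine.Point, Function.Injective f := by
  rintro ⟨f, hf⟩
  refine not_exists_addOrderOf_eq_fortyNine V ⟨f 1, ?_⟩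
  rw [addOrderOf_injective f hf, ZMod.addOrderOf_one]

/-- The leaf in the literal shape of the `n = 49` conjunct of the hypothesis `h` of
`Literature.NumberTheory.EllipticCurves.Mazur1977_reduction_to_primes_of_leaves`
(membership form). Author: bsd-cited-r09 g9. [cite: Mazur1977, Ch. III §5 p. 156] -/
theorem mazurFirstReduction_leaf_fortyNine (V : WeierstrassCurve ℚ) [V.IsElliptic] (n : ℕ)
    (hn : n ∈ ({49} : Finset ℕ)) : ¬ ∃ P : V.toAffine.Point, addOrderOf P = n := by
  rw [Finset.mem_singleton] at hn
  subst hn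
  exact not_exists_addOrderOf_eq_fortyNine V

/-- **Mazur's First reduction from three leaves.** If no elliptic curve over `ℚ` has a rational
point of order `n` for `n ∈ {18, 25, 35}`, then Mazur's torsion theorem for composite orders
follows from the prime case (`Mazur1977_reduction_to_primes`): the leaf `n = 49` of the tree's
`Mazur1977_reduction_to_primes_of_four_leaves` (file `MazurTorsionReductionFourLeavesProofs`,
leaves `18, 25, 35, 49`) is discharged by `not_exists_addOrderOf_eq_fortyNine`, i.e. the named fact
is CLOSED MODULO the three statements "`X₁(18)(ℚ)`, `X₁(25)(ℚ)`, `X₀(35)(ℚ)` are cuspidal"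
(Kubert 1976, Ch. IV; Kenku; Ligozat). Author: bsd-cited-r19.
[cite: Mazur1977, Ch. III §5 p. 156 (First reduction, after Kubert); Kubert1976, Ch. IV] -/
theorem Mazur1977_reduction_to_primes_of_three_leaves
    (h : ∀ (V : WeierstrassCurve ℚ) [V.IsElliptic] (n : ℕ),
      n ∈ ({18, 25, 35} : Finset ℕ) → ¬ ∃ P : V.toAffine.Point, addOrderOf P = n) :
    Mazur1977_reduction_to_primes :=
  Mazur1977_reduction_to_primes_of_four_leaves fun V _ n hn ↦ by
    have key : ∀ m ∈ ({18, 25, 35, 49} : Finset ℕ), m = 49 ∨ m ∈ ({18, 25, 35} : Finset ℕ) := by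
      decide
    rcases key n hn with rfl | hn3
    · exact not_exists_addOrderOf_eq_fortyNine V
    · exact h V n hn3

end Literature.NumberTheory.EllipticCurves

end
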